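import Summits.ResolutionOfSingularities.ResolutionOfSingularities.Theorems.ConeCutRepeats
import HarnessLib

/-!
# ConeCutLawE — tree file 7/11: §B⁺⁺⁺ part 2 — LAW E `third_repeat` (a repeat preceded by two repeats is
an UNTRANSLATED ZIGZAG
step), `third_repeat_plateau`, and `isTameFrom_of_plateau` (every high plateau is tame; `IsTameFrom` from
`ConeCutClasses`).  PROVED.

Content VERBATIM from the decomp-res lens-3 g15 file `HOME/decomp-res-lens-3/g15/parts/ConeCut-rev5-f76e5309.lean`
(sha256 f76e53096babc227…; CRITIC-LEDGER
rows 102/105/110/123 CLEARED, landing orders 15:53:15Z / 17:40:15Z).  HOME = run/shared/lean/pub/decomp-res.  Host: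
route `MaxContactCut`, aside
31770 `DefectWalksDeep` (and 31870) through the tree's lens-3 g14 `Theorems/FloorCut{Classes,Floor}` + `MaxContactCutFloorCut`.

[WRITER NOTE (decomp-res writer g6): per the lens's own landing instruction its §0 (l.130–876 = g14 `FloorCut`
VERBATIM) is DELETED and the
tree's `…Theorems.FloorCut` opened instead; §C⁵ `section AxisLaw` (l.2949–3086) is the tree's
`Theorems/ConeCutAxisLaw` (landed earlier,
opened here); the restated ProximityCut letters `LeavesNewest` / `StaysOnNewest` / `leavesNewest_iff_not_stays` /
`NoFreePointTailsDeep`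
(byte-identical to `Theorems/ProximityCutClasses`) are deleted and opened from the tree; the three class definitions
`IsTameFrom`,
`NoMixedTailsDeep`, `NoTameMixedTailsDeep` live in the cone-free `Theorems/ConeCutClasses` (so the route can import
the co-owned MIXED
aside).  Split: ConeCutClasses · ConeCutLayers / ConeCutLayersPoint (§A state level) · ConeCutWalks (§B) ·
ConeCutLawB (§C) · ConeCutRepeats
(§B⁺, §B⁺⁺⁺ part 1) · ConeCutLawE (§B⁺⁺⁺ part 2, LAW E) · ConeCutZigzag (§B⁺⁺
Fibonacci/zigzag, LAW C) · ConeCutLaws (all-repeat rigidity,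
LAW I, §D booking) · MaxContactCutConeCut / MaxContactCutConeCutCells (§D wiring to 31770/31870 BY NAME, Theses
cone).  ONE namespace
`…Theorems.ConeCut` as in the lens; global `set_option` lines dropped; nothing else changed.]
(Sources: Hauser2010 §§D,F,G; HauserPerlega2019; Moh1987; CossartPiltant2019; CossartJannsenSaito2020 Thm. 2.14,
§§5,9; BenitoVillamayor2013 §7; CasasAlvero2000 Ch. 3; BierstoneGrigorievMilmanWlodarczyk2011 Def. 3.1.3.)
-/

noncomputable section

open MvPolynomial Finset
open Literature.AlgebraicGeometry.Resolution
open Literature.AlgebraicGeometry.Resolution.Hauser2010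
open Literature.AlgebraicGeometry.Resolution.PointBlowup
open Summit.ResolutionOfSingularities.ResolutionOfSingularities.Theorems.TightDefectClasses
open Summit.ResolutionOfSingularities.ResolutionOfSingularities.Theorems.TightDefectStrongWalks
open Summit.ResolutionOfSingularities.ResolutionOfSingularities.Theorems.ItineraryCutClasses
open Summit.ResolutionOfSingularities.ResolutionOfSingularities.Theorems.BoundaryLedger
open Literature.AlgebraicGeometry.Resolution.WeightedBlowup
open Literature.Barriers.ResolutionOfSingularities
open Summit.ResolutionOfSingularities.ResolutionOfSingularities.Theorems.FloorCut
open Summit.ResolutionOfSingularities.ResolutionOfSingularities.Theorems.ConeCutAxisLaw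
open Summit.ResolutionOfSingularities.ResolutionOfSingularities.Theorems.ProximityCut (NoOriginTails LeavesNewest StaysOnNewest)
open Summit.ResolutionOfSingularities.ResolutionOfSingularities.Theorems.ProximityCut (leavesNewest_iff_not_stays NoFreePointTailsDeep)
open Summit.ResolutionOfSingularities.ResolutionOfSingularities.Theorems.ExitLaw (fin3_cases)

namespace Summit.ResolutionOfSingularities.ResolutionOfSingularities.Theorems.ConeCut

section ThirdRepeat

variable {K : Type} [Field K] [DecidableEq K] {q : ℕ} {s₀ : State (Fin 3) K}

/-- **THE OLDER-FACE LAW (PROVED — the new coefficient law of rev 4).**  Two consecutive plateau moves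
`u → u+1 → u+2` from orders `> q`, shade `n ≥ 1`, the first a proximity repeat (`StaysOnNewest W u`:
`j_{u+1} = N ≠ a = j_u`, `b_{u+1}(a) = 0`).  Then `F_{u+2}` has NO monomial `x^{r_{u+2}} · u_N^{n}`. [new] [folklore] -/
theorem older_face_vanish (hroot : IsRoot q s₀) (W : ForcedWalk q s₀) (u : ℕ) {o o₁ : ℕ}
    (ho : ordZero (W.st u).F = o) (ho₁ : ordZero (W.st (u + 1)).F = o₁) (hqo : q < o) (hqo₁ : q < o₁)
    (hplat : (W.st (u + 1)).shade = (W.st u).shade) (hplat₁ : (W.st (u + 2)).shade = (W.st (u + 1)).shade)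
    {n : ℕ} (hn : (W.st u).shade = (n : ℕ∞)) (hn1 : 1 ≤ n) (hS₀ : StaysOnNewest W u) :
    coeff ((W.st (u + 2)).r + Finsupp.single (W.j (u + 1)) n) (W.st (u + 2)).F = 0 := by
  classical
  obtain ⟨o₀, ho₀, -, ho2⟩ := NoJump.order_lt_two_mul hroot W u
  have hoo : o₀ = o := by have h := ho₀.symm.trans ho; exact_mod_cast h
  rw [hoo] at ho2
  have hNa : W.j (u + 1) ≠ W.j u := hS₀.1
  have hb'a : W.b (u + 1) (W.j u) = 0 := hS₀.2
  have hb'N : W.b (u + 1) (W.j (u + 1)) = 0 := W.onExc (u + 1)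
  obtain ⟨k, hka, hkN⟩ := exists_third hNa.symm
  -- boundary bookkeeping: `r_{u+1} = kept_u + (o − q)e_a`, `r_{u+2} = kept_{u+1} + (o₁ − q)e_N`
  have hr₁ : (W.st (u + 1)).r = kept W u + Finsupp.single (W.j u) (o - q) := r_succ_eq W u ho
  have hr₂ : (W.st (u + 2)).r = kept W (u + 1) + Finsupp.single (W.j (u + 1)) (o₁ - q) :=
    r_succ_eq W (u + 1) ho₁
  have hk0a : kept W u (W.j u) = 0 := by rw [kept_apply, if_neg (fun h => h.1 rfl)]
  have hk1N : kept W (u + 1) (W.j (u + 1)) = 0 := by rw [kept_apply, if_neg (fun h => h.1 rfl)]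
  have hk1a : kept W (u + 1) (W.j u) = o - q := by
    rw [kept_apply, if_pos ⟨hNa.symm, hb'a⟩, hr₁, Finsupp.add_apply, hk0a, Finsupp.single_eq_same, zero_add]
  have hk1k : kept W (u + 1) k = if W.b (u + 1) k = 0 then kept W u k else 0 := by
    rw [kept_apply, hr₁, Finsupp.add_apply, Finsupp.single_eq_of_ne hka, add_zero]
    by_cases h : W.b (u + 1) k = 0
    · rw [if_pos ⟨hkN, h⟩, if_pos h]
    · rw [if_neg (fun h' => h h'.2), if_neg h]
  have hDN : ((W.st (u + 2)).r + Finsupp.single (W.j (u + 1)) n) (W.j (u + 1)) = o₁ + n - q := by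
    rw [Finsupp.add_apply, hr₂, Finsupp.add_apply, hk1N, Finsupp.single_eq_same, Finsupp.single_eq_same]
    omega
  have hDa : ((W.st (u + 2)).r + Finsupp.single (W.j (u + 1)) n) (W.j u) = o - q := by
    rw [Finsupp.add_apply, hr₂, Finsupp.add_apply, hk1a, Finsupp.single_eq_of_ne hNa.symm,
      Finsupp.single_eq_of_ne hNa.symm, add_zero, add_zero]
  have hE : ((W.st (u + 2)).r + Finsupp.single (W.j (u + 1)) n).update (W.j (u + 1)) 0 = kept W (u + 1) := by
    ext l
    rw [update_apply']
    split_ifs with hl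
    · rw [hl, hk1N]
    · rw [Finsupp.add_apply, hr₂, Finsupp.add_apply, Finsupp.single_eq_of_ne hl, Finsupp.single_eq_of_ne hl,
        add_zero, add_zero]
  -- (1) nothing is deleted at this exponent: its `a`-coordinate `o − q ∈ (0, q)` is no multiple of `q`
  have hst : W.st (u + 2) = step q (W.j (u + 1)) (W.b (u + 1)) (W.st (u + 1)) := W.st_succ (u + 1)
  have hF : (W.st (u + 2)).F = deletePthPowers q (pointTransform q (W.j (u + 1)) (W.b (u + 1)) (W.st (u + 1))) := by
    rw [hst]
    rfl
  have hdel : coeff ((W.st (u + 2)).r + Finsupp.single (W.j (u + 1)) n) (W.st (u + 2)).F =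
      coeff ((W.st (u + 2)).r + Finsupp.single (W.j (u + 1)) n)
        (pointTransform q (W.j (u + 1)) (W.b (u + 1)) (W.st (u + 1))) := by
    rw [hF, coeff_deletePthPowers, if_neg]
    intro hP
    have h := (isPthPowerExponent_iff q _).mp hP (W.j u)
    rw [hDa] at h
    have := Nat.le_of_dvd (by omega) h
    omega
  rw [hdel, coeff_pointTransform_layer q (W.j (u + 1)) (W.b (u + 1)) hb'N (W.st (u + 1)) (o := o₁ + n)
    (by omega) hDN, hE]
  -- (2) the `a`-face of `F_{u+1}` above the boundary is `Φ = Bnd · N_u`, `N_u = c₁ (u_k − β₁ u_N)^n`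
  obtain ⟨c₁, -, hres⟩ := resForm_eq_pow_of_repeat hroot W u ho ho₁ hqo hqo₁ hplat hplat₁ hn ⟨hS₀.1, hS₀.2⟩
    hkN hka
  have hst₁ : W.st (u + 1) = step q (W.j u) (W.b u) (W.st u) := W.st_succ u
  have hface : ∀ E : Fin 3 →₀ ℕ, E (W.j u) = 0 → coeff (E + Finsupp.single (W.j u) (o - q)) (W.st (u + 1)).F =
      coeff E (translate (W.b u) (initLayer (W.j u) (W.st u).F o)) := by
    intro E hEa
    rw [hst₁]
    exact coeff_step_layer (W.j u) (W.b u) (W.onExc u) (W.st u) hqo ho2 hEa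
  have hΦ : translate (W.b u) (initLayer (W.j u) (W.st u).F o) =
      translate (W.b u) (monomial ((W.st u).r.update (W.j u) 0) 1) *
        (C c₁ * (X k - C (W.b (u + 1) k) * X (W.j (u + 1))) ^ n) := by
    rw [initLayer_eq_mul (W.j u) (W.st u) (walk_r hroot W u) o, ← hres]
    exact map_mul _ _ _
  have hsplit : ∀ d : Fin 3 →₀ ℕ, d (W.j u) = o - q → d.update (W.j u) 0 + Finsupp.single (W.j u) (o - q) = d := by
    intro d hda
    ext l
    rw [Finsupp.add_apply, update_apply']
    split_ifs with hl
    · rw [hl, Finsupp.single_eq_same, zero_add, hda]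
    · rw [Finsupp.single_eq_of_ne hl, add_zero]
  -- expand the translated layer of `F_{u+1}` termwise
  unfold initLayer
  rw [translate_finset_sum, coeff_sum]
  by_cases hβ : W.b (u + 1) k = 0
  · -- CASE `β₁ = 0`: the face is `u_k^n`-divisible above `kept_u`; no term reaches the exponent `kept_{u+1}`
    have hb0 : ∀ i, W.b (u + 1) i = 0 := by
      intro i
      rcases fin3_cases hNa.symm hka hkN i with h | h | h
      · rw [h]; exact hb'a
      · rw [h]; exact hb'N
      · rw [h]; exact hβ
    refine Finset.sum_eq_zero fun d _ => ?_
    by_cases hdk : d.update (W.j (u + 1)) 0 = kept W (u + 1)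
    · have hda : d (W.j u) = o - q := by
        have h := DFunLike.congr_fun hdk (W.j u)
        rwa [update_apply', if_neg hNa.symm, hk1a] at h
      have hdk' : d k = kept W u k := by
        have h := DFunLike.congr_fun hdk k
        rwa [update_apply', if_neg hkN, hk1k, if_pos hβ] at h
      have hcoef : coeff d (W.st (u + 1)).F = 0 := by
        rw [← hsplit d hda, hface _ (by rw [update_apply', if_pos rfl]), hΦ, hβ, map_zero, zero_mul, sub_zero,
          translate_boundary_split (W.j u) (W.b u) (W.onExc u) (W.st u).r, mul_assoc, coeff_monomial_mul']
        split_ifs with hle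
        · rw [X_pow_eq_monomial, C_mul_monomial, mul_one, coeff_mul_monomial', if_neg, mul_zero]
          intro hle'
          have h1 := Finsupp.le_def.mp hle' k
          rw [Finsupp.single_eq_same, Finsupp.tsub_apply, update_apply', if_neg hka, hdk'] at h1
          change n ≤ kept W u k - kept W u k at h1
          omega
        · rfl
      rw [hcoef, monomial_zero]
      unfold PointBlowup.translate
      rw [map_zero, coeff_zero]
    · obtain ⟨i, hi⟩ := DFunLike.ne_iff.mp hdk
      rcases lt_or_gt_of_ne hi with hlt | hgt
      · exact coeff_translate_monomial_eq_zero_of_lt _ _ _ _ hlt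
      · exact coeff_translate_monomial_eq_zero_of_apply_eq_zero _ _ _ _ (hb0 i) hgt
  · -- CASE `β₁ ≠ 0`: `kept_{u+1} = (o − q)e_a`; the coefficient is a homogeneous slice of `Φ` on the line `u_k = β₁u_N`
    have hK : kept W (u + 1) = Finsupp.single (W.j u) (o - q) := by
      ext l
      rcases fin3_cases hNa.symm hka hkN l with h | h | h
      · rw [h, hk1a, Finsupp.single_eq_same]
      · rw [h, hk1N, Finsupp.single_eq_of_ne hNa]
      · rw [h, hk1k, if_neg hβ, Finsupp.single_eq_of_ne hka]
    rw [hK]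
    have hterm : ∀ d : Fin 3 →₀ ℕ,
        coeff (Finsupp.single (W.j u) (o - q))
            (translate (W.b (u + 1)) (monomial (d.update (W.j (u + 1)) 0) (coeff d (W.st (u + 1)).F))) =
          if d (W.j u) = o - q then coeff d (W.st (u + 1)).F * W.b (u + 1) k ^ d k else 0 := by
      intro d
      split_ifs with hda
      · rw [coeff_translate_monomial, prod_fin3 hNa.symm hka hkN]
        have ea : (d.update (W.j (u + 1)) 0) (W.j u) = o - q := by rw [update_apply', if_neg hNa.symm, hda]
        have eN : (d.update (W.j (u + 1)) 0) (W.j (u + 1)) = 0 := by rw [update_apply', if_pos rfl]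
        have ek : (d.update (W.j (u + 1)) 0) k = d k := by rw [update_apply', if_neg hkN]
        rw [ea, eN, ek, Finsupp.single_eq_same, Finsupp.single_eq_of_ne hNa, Finsupp.single_eq_of_ne hka]
        simp only [Nat.choose_self, Nat.choose_zero_right, Nat.sub_self, Nat.sub_zero, pow_zero, Nat.cast_one,
          mul_one, one_mul]
      · rcases lt_or_gt_of_ne hda with hlt | hgt
        · exact coeff_translate_monomial_eq_zero_of_lt _ _ _ _ (i := W.j u)
            (by rw [update_apply', if_neg hNa.symm, Finsupp.single_eq_same]; exact hlt)
        · exact coeff_translate_monomial_eq_zero_of_apply_eq_zero _ _ _ _ (i := W.j u) hb'a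
            (by rw [update_apply', if_neg hNa.symm, Finsupp.single_eq_same]; exact hgt)
    rw [Finset.sum_congr rfl (fun d _ => hterm d), ← Finset.sum_filter]
    -- transport to `Φ` along `d ↦ d[a ↦ 0]`
    set Bnd := translate (W.b u) (monomial ((W.st u).r.update (W.j u) 0) (1 : K)) with hBnd
    set Φ := Bnd * (C c₁ * (X k - C (W.b (u + 1) k) * X (W.j (u + 1))) ^ n) with hΦdef
    have hfaceΦ : ∀ e : Fin 3 →₀ ℕ, e (W.j u) = 0 →
        coeff (e + Finsupp.single (W.j u) (o - q)) (W.st (u + 1)).F = coeff e Φ := by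
      intro e he
      rw [hface e he, hΦ]
    have hΦa : ∀ e ∈ Φ.support, e (W.j u) = 0 := by
      intro e he
      by_contra hne
      refine (MvPolynomial.mem_support_iff.mp he) ?_
      rw [← hΦ]
      exact coeff_translate_initLayer_eq_zero (W.j u) (W.b u) (W.onExc u) _ o hne
    have hdegupd : ∀ d : Fin 3 →₀ ℕ, (d.update (W.j u) 0).degree + d (W.j u) = d.degree := by
      intro d
      have h1 := degree_eq_add_sum_erase (W.j u) d
      have h2 := degree_eq_add_sum_erase (W.j u) (d.update (W.j u) 0)
      have hs : ∑ l ∈ Finset.univ.erase (W.j u), (d.update (W.j u) 0) l = ∑ l ∈ Finset.univ.erase (W.j u), d l :=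
        Finset.sum_congr rfl fun l hl => by rw [update_apply', if_neg (Finset.ne_of_mem_erase hl)]
      rw [update_apply', if_pos rfl, zero_add, hs] at h2
      omega
    have key := layer_eval_eq_zero (N := W.j (u + 1)) (k := k) Bnd c₁ (W.b (u + 1) k) hn1
      (fun i => if i = k then W.b (u + 1) k else 1)
      (by rw [if_pos rfl, if_neg (fun h => hkN h.symm), mul_one]) (o₁ + n - (o - q))
    rw [← hΦdef] at key
    have hprod : ∀ e : Fin 3 →₀ ℕ, (∏ i, (if i = k then W.b (u + 1) k else 1) ^ e i) = W.b (u + 1) k ^ e k := by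
      intro e
      rw [Fintype.prod_eq_single k (fun i hi => by rw [if_neg hi, one_pow]), if_pos rfl]
    simp only [hprod] at key
    rw [Finset.sum_nbij' (fun d => d.update (W.j u) 0) (fun e => e + Finsupp.single (W.j u) (o - q))
      (t := Φ.support.filter (fun e => e.degree = o₁ + n - (o - q)))
      (g := fun e => coeff e Φ * W.b (u + 1) k ^ e k) ?hi ?hj ?hli ?hri ?hfg]
    · exact key
    case hi =>
      intro d hd
      obtain ⟨hd1, hda⟩ := Finset.mem_filter.mp hd
      obtain ⟨hsupp, hdeg⟩ := Finset.mem_filter.mp hd1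
      refine Finset.mem_filter.mpr ⟨MvPolynomial.mem_support_iff.mpr ?_, ?_⟩
      · rw [← hfaceΦ _ (by rw [update_apply', if_pos rfl]), hsplit d hda]
        exact MvPolynomial.mem_support_iff.mp hsupp
      · have := hdegupd d
        omega
    case hj =>
      intro e he
      obtain ⟨hsupp, hdeg⟩ := Finset.mem_filter.mp he
      have hea := hΦa e hsupp
      refine Finset.mem_filter.mpr ⟨Finset.mem_filter.mpr ⟨MvPolynomial.mem_support_iff.mpr ?_, ?_⟩, ?_⟩
      · rw [hfaceΦ e hea]
        exact MvPolynomial.mem_support_iff.mp hsupp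
      · rw [map_add, Finsupp.degree_single]
        omega
      · rw [Finsupp.add_apply, hea, Finsupp.single_eq_same, zero_add]
    case hli =>
      intro d hd
      exact hsplit d (Finset.mem_filter.mp hd).2
    case hri =>
      intro e he
      have hea := hΦa e (Finset.mem_filter.mp he).1
      ext l
      rw [update_apply']
      split_ifs with hl
      · rw [hl, hea]
      · rw [Finsupp.add_apply, Finsupp.single_eq_of_ne hl, add_zero]
    case hfg =>
      intro d hd
      have hda := (Finset.mem_filter.mp hd).2
      show coeff d (W.st (u + 1)).F * W.b (u + 1) k ^ d k =
        coeff (d.update (W.j u) 0) Φ * W.b (u + 1) k ^ (d.update (W.j u) 0) k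
      rw [update_apply', if_neg hka, ← hfaceΦ _ (by rw [update_apply', if_pos rfl]), hsplit d hda]

/-- **LAW E — THE THIRD-REPEAT LAW (PROVED).**  Four consecutive plateau moves `u → u+1 → u+2 → u+3 → u+4` from orders
`> q`, shade `n ≥ 1`, the first three proximity repeats (`StaysOnNewest W u, (u+1), (u+2)`).  Then the third repeat is
an UNTRANSLATED ZIGZAG step: `b_{u+3} = 0` and `j_{u+3} = j_{u+1}`.  (So: every proximity repeat preceded by two
proximity repeats is translation-free and returns to the penultimate chart; translations on a high plateau happen only
at F-moves and at the first two repeats of a repeat run.) [new] [folklore] -/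
theorem third_repeat (hroot : IsRoot q s₀) (W : ForcedWalk q s₀) (u : ℕ) {o o₁ o₂ o₃ : ℕ}
    (ho : ordZero (W.st u).F = o) (ho₁ : ordZero (W.st (u + 1)).F = o₁) (ho₂ : ordZero (W.st (u + 2)).F = o₂)
    (ho₃ : ordZero (W.st (u + 3)).F = o₃) (hqo : q < o) (hqo₁ : q < o₁) (hqo₂ : q < o₂) (hqo₃ : q < o₃)
    (hplat : (W.st (u + 1)).shade = (W.st u).shade) (hplat₁ : (W.st (u + 2)).shade = (W.st (u + 1)).shade)
    (hplat₂ : (W.st (u + 3)).shade = (W.st (u + 2)).shade) (hplat₃ : (W.st (u + 4)).shade = (W.st (u + 3)).shade)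
    {n : ℕ} (hn : (W.st u).shade = (n : ℕ∞)) (hn1 : 1 ≤ n)
    (hS₀ : StaysOnNewest W u) (hS₁ : StaysOnNewest W (u + 1)) (hS₂ : StaysOnNewest W (u + 2)) :
    W.b (u + 3) = 0 ∧ W.j (u + 3) = W.j (u + 1) :=
  third_repeat_of_face hroot W u ho₂ ho₃ hqo₂ hqo₃ hplat₂ hplat₃ (hplat₁.trans (hplat.trans hn)) hn1 hS₁ hS₂
    (older_face_vanish hroot W u ho ho₁ hqo hqo₁ hplat hplat₁ hn hn1 hS₀)

/-- **LAW E, plateau form (PROVED)**: on a high plateau of shade `s ≥ 1`, a repeat preceded by two repeats is an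
untranslated zigzag step. [new] [folklore] -/
theorem third_repeat_plateau (hroot : IsRoot q s₀) (W : ForcedWalk q s₀) {N s : ℕ} (hs : 1 ≤ s)
    (hplat : ∀ t, N ≤ t → (W.st t).shade = (s : ℕ∞) ∧ ((q : ℕ) : ℕ∞) < ordZero (W.st t).F)
    {t : ℕ} (ht : N ≤ t) (hS : StaysOnNewest W t) (hS' : StaysOnNewest W (t + 1))
    (hS'' : StaysOnNewest W (t + 2)) : W.b (t + 3) = 0 ∧ W.j (t + 3) = W.j (t + 1) := by
  obtain ⟨o, ho, -⟩ := walk_nat hroot W t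
  obtain ⟨o', ho', -⟩ := walk_nat hroot W (t + 1)
  obtain ⟨o'', ho'', -⟩ := walk_nat hroot W (t + 2)
  obtain ⟨o''', ho''', -⟩ := walk_nat hroot W (t + 3)
  have hlt : ∀ u, N ≤ u → ∀ {m : ℕ}, ordZero (W.st u).F = m → q < m := by
    intro u hu m hm
    have h := (hplat u hu).2
    rw [hm] at h
    exact_mod_cast h
  have heq : ∀ u, N ≤ u → (W.st (u + 1)).shade = (W.st u).shade := fun u hu => by
    rw [(hplat (u + 1) (by omega)).1, (hplat u hu).1]
  exact third_repeat hroot W t ho ho' ho'' ho''' (hlt t ht ho) (hlt (t + 1) (by omega) ho')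
    (hlt (t + 2) (by omega) ho'') (hlt (t + 3) (by omega) ho''') (heq t ht) (heq (t + 1) (by omega))
    (heq (t + 2) (by omega)) (heq (t + 3) (by omega)) (hplat t ht).1 hs hS hS' hS''

/-- **Every high plateau of shade `s ≥ 1` is TAME (LAW E, PROVED).** [new] [folklore] -/
theorem isTameFrom_of_plateau (hroot : IsRoot q s₀) (W : ForcedWalk q s₀) {N s : ℕ} (hs : 1 ≤ s)
    (hplat : ∀ t, N ≤ t → (W.st t).shade = (s : ℕ∞) ∧ ((q : ℕ) : ℕ∞) < ordZero (W.st t).F) : IsTameFrom W N :=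
  fun _ ht hS hS' hS'' => third_repeat_plateau hroot W hs hplat ht hS hS' hS''

end ThirdRepeat

end Summit.ResolutionOfSingularities.ResolutionOfSingularities.Theorems.ConeCut
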